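import Mathlib.Analysis.MeanInequalities
import Mathlib.Analysis.SpecialFunctions.Pow.Real
import Mathlib.Algebra.BigOperators.Fin
import HarnessLib

/-!
# One-component regularity: the Young-inequality bookkeeping (Lemarié-Rieusset 2016, §11.5, proof of Prop. 11.5, (11.28)–(11.30))

Analysis/FluidPDE proof file (theorems only: no definition, no named fact, no `sorry`).
Search for candidate a priori estimates; no regularity claim (cell `pub-nsfunc`, literature seat:
this file formalises a PUBLISHED computation; nothing new). Fourth brick of the discharge of the
named fact `Literature.Analysis.FluidPDE.oneComponentGradientCriterion`
(`GradientRegularityCriteria.lean`; P. G. Lemarié-Rieusset, *The Navier–Stokes Problem in the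
21st Century* (2016), §11.5 Prop. 11.5, PDF pp. 354–357, after Y. Zhou 2002 and the survey's
references). This file contains NO analysis: it is the real-variable bookkeeping that turns the
slice bounds of `OneComponentVorticityBalance`, `OneComponentEnstrophyProduction` and
`OneComponentSliceBounds` into the differential inequality of the two-level functional
`1 + ‖∇u‖₂² + ‖ω₃‖₂⁴` (the book's `‖u‖²_{Ḣ¹}` and `‖ω₃‖₂²`, (11.28) and (11.30)): every production
term is split by the weighted arithmetic–geometric mean inequality (Young) into a quarter of the
dissipation `ν‖Δu‖₂²`, resp. `ν‖ω₃‖₂²‖∇ω₃‖₂²`, plus `C (1 + ‖∇u₃‖_r^q + ‖∇u‖₂²) × (functional)` with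
`q = 4r/(3r-6)`, i.e. `2/q + 3/r = 3/2` — exactly the exponent relation of Prop. 11.5. (The book
keeps the energy `‖u‖₂` in the constants; here the extra factor `‖∇u‖₂²`, integrable in time for a
Leray solution, is put into the Grönwall weight instead, which avoids the case distinction at
`r = 4`.)

* `oneComponent_slice_algebra` — the bookkeeping, with an existential constant depending only on
  `ν`, `r` and the four fixed constants (Sobolev `K₁`, `K₃`, Agmon `K_A`, `κ = ‖curl‖`).

## References

* [LemarieRieusset2016] P. G. Lemarié-Rieusset, *The Navier–Stokes Problem in the 21st Century*,
  CRC Press 2016, §11.5, proof of Prop. 11.5, (11.28)–(11.30) (held text, PDF pp. 355–356).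
-/

noncomputable section

open Finset

namespace Literature.Analysis.FluidPDE

/-! ### Young-type absorption lemmas -/

section YoungOC

/-- **Weighted AM–GM with two absorbed factors**: for `A, B, Z ≥ 0`, `α, β ≥ 0`, `α + β < 1`,
`ε > 0`: `A^α B^β Z ≤ εA + εB + ε^{-(α+β)/(1-α-β)} Z^{1/(1-α-β)}`. [folklore] -/
private theorem young3_oc {A B Z α β ε : ℝ} (hA : 0 ≤ A) (hB : 0 ≤ B) (hZ : 0 ≤ Z)
    (hα : 0 ≤ α) (hβ : 0 ≤ β) (hαβ : α + β < 1) (hε : 0 < ε) :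
    A ^ α * B ^ β * Z ≤
      ε * A + ε * B + (1 / ε) ^ ((α + β) / (1 - α - β)) * Z ^ (1 / (1 - α - β)) := by
  have hγ0 : 0 < 1 - α - β := by linarith
  set γ := 1 - α - β with hγ
  set δ : ℝ := 1 / ε with hδ
  have hδ0 : 0 < δ := by positivity
  have hα1 : α ≤ 1 := by linarith
  have hβ1 : β ≤ 1 := by linarith
  have hγ1 : γ ≤ 1 := by linarith
  have hp3 : 0 ≤ (δ ^ (α + β) * Z) ^ (1 / γ) := by positivity
  have key := Real.geom_mean_le_arith_mean3_weighted (p₁ := A / δ) (p₂ := B / δ)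
    (p₃ := (δ ^ (α + β) * Z) ^ (1 / γ)) hα hβ hγ0.le (by positivity) (by positivity)
    hp3 (by linarith)
  have h1 : 0 < δ ^ α := Real.rpow_pos_of_pos hδ0 _
  have h2 : 0 < δ ^ β := Real.rpow_pos_of_pos hδ0 _
  have hL : (A / δ) ^ α * (B / δ) ^ β * ((δ ^ (α + β) * Z) ^ (1 / γ)) ^ γ =
      A ^ α * B ^ β * Z := by
    rw [← Real.rpow_mul (mul_nonneg (Real.rpow_nonneg hδ0.le _) hZ), one_div_mul_cancel hγ0.ne',
      Real.rpow_one, Real.div_rpow hA hδ0.le, Real.div_rpow hB hδ0.le, Real.rpow_add hδ0,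
      div_mul_div_comm, div_mul_eq_mul_div, div_eq_iff (mul_pos h1 h2).ne']
    ring
  rw [hL] at key
  refine key.trans ?_
  have hAδ : A / δ = ε * A := by rw [hδ, div_div_eq_mul_div, div_one, mul_comm]
  have hBδ : B / δ = ε * B := by rw [hδ, div_div_eq_mul_div, div_one, mul_comm]
  have t1 : α * (A / δ) ≤ ε * A := by
    rw [hAδ]; exact mul_le_of_le_one_left (by positivity) hα1
  have t2 : β * (B / δ) ≤ ε * B := by
    rw [hBδ]; exact mul_le_of_le_one_left (by positivity) hβ1
  have heq : (δ ^ (α + β) * Z) ^ (1 / γ) = (1 / ε) ^ ((α + β) / γ) * Z ^ (1 / γ) := by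
    rw [Real.mul_rpow (Real.rpow_nonneg hδ0.le _) hZ, ← Real.rpow_mul hδ0.le, hδ]
    congr 2
    field_simp
  have t3 : γ * (δ ^ (α + β) * Z) ^ (1 / γ) ≤ (1 / ε) ^ ((α + β) / γ) * Z ^ (1 / γ) := by
    rw [← heq]; exact mul_le_of_le_one_left hp3 hγ1
  linarith

/-- **Weighted AM–GM with one absorbed factor**: for `A, Z ≥ 0`, `0 ≤ α < 1`, `ε > 0`:
`A^α Z ≤ εA + ε^{-α/(1-α)} Z^{1/(1-α)}`. [folklore] -/
private theorem young2_oc {A Z α ε : ℝ} (hA : 0 ≤ A) (hZ : 0 ≤ Z) (hα : 0 ≤ α) (hα1 : α < 1)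
    (hε : 0 < ε) :
    A ^ α * Z ≤ ε * A + (1 / ε) ^ (α / (1 - α)) * Z ^ (1 / (1 - α)) := by
  have h := young3_oc (B := 0) (β := 0) hA le_rfl hZ hα le_rfl (by linarith) hε
  simp only [Real.rpow_zero, mul_one, mul_zero, add_zero, sub_zero] at h
  exact h

/-- `x^a ≤ 1 + x^b` for `x ≥ 0` and `0 ≤ a ≤ b`. [folklore] -/
private theorem rpow_le_one_add_rpow_oc {x a b : ℝ} (hx : 0 ≤ x) (ha : 0 ≤ a) (hab : a ≤ b) :
    x ^ a ≤ 1 + x ^ b := by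
  rcases le_or_gt x 1 with h | h
  · exact (Real.rpow_le_one hx h ha).trans (le_add_of_nonneg_right (Real.rpow_nonneg hx b))
  · exact (Real.rpow_le_rpow_of_exponent_le h.le hab).trans (le_add_of_nonneg_left zero_le_one)

/-- Young's inequality without the `1/p`, `1/q` factors: `x y ≤ x^p + y^q` for conjugate
exponents and `x, y ≥ 0`. [folklore] -/
private theorem mul_le_rpow_add_rpow_oc {x y p q : ℝ} (hx : 0 ≤ x) (hy : 0 ≤ y)
    (hpq : p.HolderConjugate q) : x * y ≤ x ^ p + y ^ q := by
  have h := Real.young_inequality_of_nonneg hx hy hpq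
  have h1 : x ^ p / p ≤ x ^ p := div_le_self (Real.rpow_nonneg hx p) hpq.lt.le
  have h2 : y ^ q / q ≤ y ^ q := div_le_self (Real.rpow_nonneg hy q) hpq.symm.lt.le
  linarith

end YoungOC

/-! ### The four production terms -/

section Terms

/-- The weight term `(5/2+8κ) T_c`, `T_c ≤ Σⱼ N aⱼ^{1-3/(2r)} (K²Rⱼ)^{3/(2r)}`:
`c₁ T_c ≤ εA + C (1 + N^q) E`. [folklore] -/
private theorem term_c_oc {r K ε c₁ : ℝ} (hr2 : 2 < r) (hε : 0 < ε) (hc₁ : 0 < c₁) :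
    ∃ C : ℝ, 0 ≤ C ∧ ∀ (N E A Tc : ℝ) (a R : Fin 3 → ℝ), 0 ≤ N → 0 ≤ E →
      (∀ j, 0 ≤ a j) → (∀ j, 0 ≤ R j) → ∑ j, a j = E → ∑ j, R j = A →
      Tc ≤ ∑ j, N * a j ^ (1 - 3 / (2 * r)) * (K ^ 2 * R j) ^ (3 / (2 * r)) →
      c₁ * Tc ≤ ε * A + C * (1 + N ^ (4 * r / (3 * r - 6))) * E := by
  have hr0 : 0 < r := by linarith only [hr2]
  have h2r3 : 0 < 2 * r - 3 := by linarith only [hr2]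
  have h3r6 : 0 < 3 * r - 6 := by linarith only [hr2]
  have hr0' : r ≠ 0 := hr0.ne'
  have h2r3' : 2 * r - 3 ≠ 0 := h2r3.ne'
  have h3r6' : 3 * r - 6 ≠ 0 := h3r6.ne'
  obtain ⟨q, hq⟩ : ∃ q : ℝ, q = 4 * r / (3 * r - 6) := ⟨_, rfl⟩
  obtain ⟨θ', hθ'⟩ : ∃ θ' : ℝ, θ' = 3 / (2 * r) := ⟨_, rfl⟩
  have hθ'0 : 0 ≤ θ' := by rw [hθ']; positivity
  have hθ'1 : θ' < 1 := by rw [hθ', div_lt_one (by positivity)]; linarith only [hr2]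
  have h1θ' : 0 < 1 - θ' := by linarith only [hθ'1]
  have h1θ'e : 1 - θ' = (2 * r - 3) / (2 * r) := by
    rw [hθ', eq_div_iff (by positivity)]
    field_simp
  obtain ⟨pc, hpc⟩ : ∃ pc : ℝ, pc = 1 / (1 - θ') := ⟨_, rfl⟩
  have hpce : pc = 2 * r / (2 * r - 3) := by rw [hpc, h1θ'e, one_div_div]
  have hpc0 : 0 ≤ pc := by rw [hpc]; positivity
  have hpcq : pc ≤ q := by
    rw [hpce, hq, div_le_div_iff₀ h2r3 h3r6]
    nlinarith only [hr2]
  obtain ⟨ε', hε'⟩ : ∃ ε' : ℝ, ε' = ε / (K ^ 2 + 1) := ⟨_, rfl⟩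
  have hε'0 : 0 < ε' := by rw [hε']; positivity
  have hε'K : ε' * K ^ 2 ≤ ε := by
    rw [hε', div_mul_eq_mul_div, div_le_iff₀ (by positivity)]
    nlinarith only [sq_nonneg K, hε.le]
  obtain ⟨Cc, hCc⟩ : ∃ Cc : ℝ, Cc = (1 / ε') ^ (θ' / (1 - θ')) * c₁ ^ pc := ⟨_, rfl⟩
  have hCc0 : 0 ≤ Cc := by rw [hCc]; positivity
  refine ⟨Cc, hCc0, ?_⟩
  intro N E A Tc a R hN hE ha hR haE hRA hTc
  rw [← hq]
  have hj : ∀ j, c₁ * (N * a j ^ (1 - 3 / (2 * r)) * (K ^ 2 * R j) ^ (3 / (2 * r))) ≤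
      ε * R j + Cc * N ^ pc * a j := by
    intro j
    have haj := ha j
    have hRj := hR j
    have hZ0 : 0 ≤ c₁ * N * a j ^ (1 - θ') := by positivity
    have hy := young2_oc (A := K ^ 2 * R j) (Z := c₁ * N * a j ^ (1 - θ')) (α := θ')
      (by positivity) hZ0 hθ'0 hθ'1 hε'0
    have hZp : (c₁ * N * a j ^ (1 - θ')) ^ (1 / (1 - θ')) = c₁ ^ pc * N ^ pc * a j := by
      rw [Real.mul_rpow (by positivity) (Real.rpow_nonneg haj _),
        Real.mul_rpow hc₁.le hN, ← Real.rpow_mul haj, mul_one_div_cancel h1θ'.ne',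
        Real.rpow_one, hpc]
    rw [hZp] at hy
    have hε'R : ε' * (K ^ 2 * R j) ≤ ε * R j := by
      rw [← mul_assoc]; exact mul_le_mul_of_nonneg_right hε'K hRj
    have hlast : (1 / ε') ^ (θ' / (1 - θ')) * (c₁ ^ pc * N ^ pc * a j) = Cc * N ^ pc * a j := by
      rw [hCc]; ring
    calc c₁ * (N * a j ^ (1 - 3 / (2 * r)) * (K ^ 2 * R j) ^ (3 / (2 * r)))
        = (K ^ 2 * R j) ^ θ' * (c₁ * N * a j ^ (1 - θ')) := by rw [hθ']; ring
      _ ≤ ε' * (K ^ 2 * R j) + (1 / ε') ^ (θ' / (1 - θ')) * (c₁ ^ pc * N ^ pc * a j) := hy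
      _ ≤ ε * R j + Cc * N ^ pc * a j := by rw [hlast]; linarith only [hε'R]
  have hsum : c₁ * Tc ≤ ∑ j, (ε * R j + Cc * N ^ pc * a j) := by
    calc c₁ * Tc ≤ c₁ * ∑ j, N * a j ^ (1 - 3 / (2 * r)) * (K ^ 2 * R j) ^ (3 / (2 * r)) :=
          mul_le_mul_of_nonneg_left hTc hc₁.le
      _ = ∑ j, c₁ * (N * a j ^ (1 - 3 / (2 * r)) * (K ^ 2 * R j) ^ (3 / (2 * r))) := by
          rw [Finset.mul_sum]
      _ ≤ ∑ j, (ε * R j + Cc * N ^ pc * a j) := Finset.sum_le_sum fun j _ => hj j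
  rw [Finset.sum_add_distrib, ← Finset.mul_sum, ← Finset.mul_sum, hRA, haE] at hsum
  have hNpc : N ^ pc ≤ 1 + N ^ q := rpow_le_one_add_rpow_oc hN hpc0 hpcq
  have hmono : Cc * N ^ pc * E ≤ Cc * (1 + N ^ q) * E :=
    mul_le_mul_of_nonneg_right (mul_le_mul_of_nonneg_left hNpc hCc0) hE
  linarith only [hsum, hmono]

/-- The second-derivative term `2κ T_b`: `2κ T_b ≤ εA + C (N^q + E) E`. [folklore] -/
private theorem term_b_oc {r K KA κ ε σ : ℝ} (hr2 : 2 < r) (hr6 : r ≤ 6) (hK : 0 ≤ K)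
    (hKA : 0 ≤ KA) (hκ : 0 ≤ κ) (hε : 0 < ε) (hσ : σ = 4 * r / (r - 2)) :
    ∃ C : ℝ, 0 ≤ C ∧ ∀ (N N₀ E A Tb : ℝ), 0 ≤ N → 0 ≤ N₀ → 0 ≤ E → 0 ≤ A →
      N₀ ≤ E ^ (1 / 4 : ℝ) * N ^ (1 / 2 : ℝ) →
      Tb ≤ N₀ * ((KA * (E * A) ^ (1 / 4 : ℝ)) ^ ((σ - 6) / σ) * (K * E ^ (1 / 2 : ℝ)) ^ (6 / σ)) *
          (27 * A) ^ (1 / 2 : ℝ) →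
      2 * κ * Tb ≤ ε * A + C * (N ^ (4 * r / (3 * r - 6)) + E) * E := by
  have hr0 : 0 < r := by linarith only [hr2]
  have hr2' : 0 < r - 2 := by linarith only [hr2]
  have h3r6 : 0 < 3 * r - 6 := by linarith only [hr2]
  have hr0' : r ≠ 0 := hr0.ne'
  have hr2'' : r - 2 ≠ 0 := hr2'.ne'
  have h3r6' : 3 * r - 6 ≠ 0 := h3r6.ne'
  obtain ⟨q, hq⟩ : ∃ q : ℝ, q = 4 * r / (3 * r - 6) := ⟨_, rfl⟩
  obtain ⟨τ, hτ⟩ : ∃ τ : ℝ, τ = 3 * (r - 2) / (2 * r) := ⟨_, rfl⟩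
  have hτ0 : 0 < τ := by rw [hτ]; positivity
  have hτ0' : τ ≠ 0 := hτ0.ne'
  have hτ1 : τ ≤ 1 := by rw [hτ, div_le_one (by positivity)]; linarith only [hr6]
  have h1τ : 0 < 1 + τ := by linarith only [hτ0]
  have h1τ' : 1 + τ ≠ 0 := h1τ.ne'
  have hqτ : q = 2 / τ := by
    rw [hq, hτ, div_div_eq_mul_div, div_eq_div_iff h3r6' (by positivity)]
    ring
  have hσ0 : σ ≠ 0 := by rw [hσ]; positivity
  have hσ6 : 6 / σ = τ := by
    rw [hσ, hτ, div_div_eq_mul_div, div_eq_div_iff (by positivity) (by positivity)]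
    ring
  have hσ6' : (σ - 6) / σ = 1 - τ := by rw [sub_div, div_self hσ0, hσ6]
  obtain ⟨eA, heA⟩ : ∃ eA : ℝ, eA = 1 / 4 * (1 - τ) + 1 / 2 := ⟨_, rfl⟩
  obtain ⟨eE, heE⟩ : ∃ eE : ℝ, eE = 1 / 4 + 1 / 4 * (1 - τ) + 1 / 2 * τ := ⟨_, rfl⟩
  have heA0 : 0 ≤ eA := by rw [heA]; nlinarith only [hτ1]
  have heA1 : eA < 1 := by rw [heA]; nlinarith only [hτ0]
  have h1eA : 1 - eA = (1 + τ) / 4 := by rw [heA]; ring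
  obtain ⟨pb, hpb⟩ : ∃ pb : ℝ, pb = 1 / (1 - eA) := ⟨_, rfl⟩
  have hpb' : pb = 4 / (1 + τ) := by rw [hpb, h1eA, one_div_div]
  have hpb0 : 0 < pb := by rw [hpb']; positivity
  have heEpb : eE * pb = 1 + 1 / (1 + τ) := by
    rw [hpb', heE]
    field_simp
    ring
  have hpbq : 1 / 2 * pb * ((1 + τ) / τ) = q := by
    rw [hpb', hqτ]
    field_simp
    ring
  have hconj_b : ((1 + τ) / τ).HolderConjugate (1 + τ) := by
    rw [Real.holderConjugate_iff]
    refine ⟨by rw [lt_div_iff₀ hτ0]; linarith only [hτ0], ?_⟩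
    rw [inv_div, ← one_div, div_add_div _ _ h1τ' h1τ', div_eq_one_iff_eq (mul_ne_zero h1τ' h1τ')]
    ring
  obtain ⟨cb₀, hcb₀⟩ : ∃ cb₀ : ℝ, cb₀ = KA ^ (1 - τ) * K ^ τ * (27 : ℝ) ^ (1 / 2 : ℝ) := ⟨_, rfl⟩
  have hcb₀0 : 0 ≤ cb₀ := by rw [hcb₀]; positivity
  obtain ⟨Cb, hCb⟩ : ∃ Cb : ℝ, Cb = (1 / ε) ^ (eA / (1 - eA)) * (2 * κ * cb₀) ^ pb := ⟨_, rfl⟩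
  have hCb0 : 0 ≤ Cb := by rw [hCb]; positivity
  refine ⟨Cb, hCb0, ?_⟩
  intro N N₀ E A Tb hN hN₀ hE hA hN₀le hTb
  rw [← hq]
  -- the product form
  have hEA0 : 0 ≤ E * A := mul_nonneg hE hA
  have hX : (KA * (E * A) ^ (1 / 4 : ℝ)) ^ ((σ - 6) / σ) * (K * E ^ (1 / 2 : ℝ)) ^ (6 / σ) =
      KA ^ (1 - τ) * K ^ τ * (E ^ (1 / 4 * (1 - τ)) * E ^ (1 / 2 * τ)) * A ^ (1 / 4 * (1 - τ)) := by
    rw [hσ6, hσ6', Real.mul_rpow hKA (Real.rpow_nonneg hEA0 _), ← Real.rpow_mul hEA0,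
      Real.mul_rpow hE hA, Real.mul_rpow hK (Real.rpow_nonneg hE _), ← Real.rpow_mul hE]
    ring
  have h27 : (27 * A) ^ (1 / 2 : ℝ) = (27 : ℝ) ^ (1 / 2 : ℝ) * A ^ (1 / 2 : ℝ) :=
    Real.mul_rpow (by norm_num) hA
  have hEpow : E ^ (1 / 4 : ℝ) * (E ^ (1 / 4 * (1 - τ)) * E ^ (1 / 2 * τ)) = E ^ eE := by
    rw [heE, Real.rpow_add_of_nonneg hE (by nlinarith only [hτ1]) (by nlinarith only [hτ0]),
      Real.rpow_add_of_nonneg hE (by norm_num) (by nlinarith only [hτ1])]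
    ring
  have hApow : A ^ (1 / 4 * (1 - τ)) * A ^ (1 / 2 : ℝ) = A ^ eA := by
    rw [heA, Real.rpow_add_of_nonneg hA (by nlinarith only [hτ1]) (by norm_num)]
  have hfac0 : 0 ≤ (KA * (E * A) ^ (1 / 4 : ℝ)) ^ ((σ - 6) / σ) * (K * E ^ (1 / 2 : ℝ)) ^ (6 / σ) *
      (27 * A) ^ (1 / 2 : ℝ) := by
    rw [hX, h27]
    positivity
  have hTb' : Tb ≤ cb₀ * N ^ (1 / 2 : ℝ) * E ^ eE * A ^ eA := by
    calc Tb ≤ N₀ * ((KA * (E * A) ^ (1 / 4 : ℝ)) ^ ((σ - 6) / σ) * (K * E ^ (1 / 2 : ℝ)) ^ (6 / σ)) *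
          (27 * A) ^ (1 / 2 : ℝ) := hTb
      _ = N₀ * ((KA * (E * A) ^ (1 / 4 : ℝ)) ^ ((σ - 6) / σ) * (K * E ^ (1 / 2 : ℝ)) ^ (6 / σ) *
          (27 * A) ^ (1 / 2 : ℝ)) := by ring
      _ ≤ (E ^ (1 / 4 : ℝ) * N ^ (1 / 2 : ℝ)) * ((KA * (E * A) ^ (1 / 4 : ℝ)) ^ ((σ - 6) / σ) *
          (K * E ^ (1 / 2 : ℝ)) ^ (6 / σ) * (27 * A) ^ (1 / 2 : ℝ)) :=
          mul_le_mul_of_nonneg_right hN₀le hfac0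
      _ = cb₀ * N ^ (1 / 2 : ℝ) * (E ^ (1 / 4 : ℝ) * (E ^ (1 / 4 * (1 - τ)) * E ^ (1 / 2 * τ))) *
          (A ^ (1 / 4 * (1 - τ)) * A ^ (1 / 2 : ℝ)) := by rw [hX, h27, hcb₀]; ring
      _ = cb₀ * N ^ (1 / 2 : ℝ) * E ^ eE * A ^ eA := by rw [hEpow, hApow]
  -- Young
  have hZ0 : 0 ≤ 2 * κ * cb₀ * N ^ (1 / 2 : ℝ) * E ^ eE := by positivity
  have hy := young2_oc (A := A) (Z := 2 * κ * cb₀ * N ^ (1 / 2 : ℝ) * E ^ eE) (α := eA) hA hZ0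
    heA0 heA1 hε
  have h2κ : 0 ≤ 2 * κ * cb₀ := by positivity
  have hZp : (2 * κ * cb₀ * N ^ (1 / 2 : ℝ) * E ^ eE) ^ (1 / (1 - eA)) =
      (2 * κ * cb₀) ^ pb * (N ^ (1 / 2 * pb) * E ^ (1 / (1 + τ))) * E := by
    rw [← hpb, Real.mul_rpow (mul_nonneg h2κ (Real.rpow_nonneg hN _)) (Real.rpow_nonneg hE _),
      Real.mul_rpow h2κ (Real.rpow_nonneg hN _), ← Real.rpow_mul hN, ← Real.rpow_mul hE, heEpb,
      Real.rpow_add_of_nonneg hE zero_le_one (by positivity), Real.rpow_one]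
    ring
  have hyoung : N ^ (1 / 2 * pb) * E ^ (1 / (1 + τ)) ≤ N ^ q + E := by
    have h := mul_le_rpow_add_rpow_oc (Real.rpow_nonneg hN (1 / 2 * pb))
      (Real.rpow_nonneg hE (1 / (1 + τ))) hconj_b
    rwa [← Real.rpow_mul hN, ← Real.rpow_mul hE, hpbq, one_div_mul_cancel h1τ',
      Real.rpow_one] at h
  have hlast : (1 / ε) ^ (eA / (1 - eA)) *
        ((2 * κ * cb₀) ^ pb * (N ^ (1 / 2 * pb) * E ^ (1 / (1 + τ))) * E) =
      Cb * ((N ^ (1 / 2 * pb) * E ^ (1 / (1 + τ))) * E) := by rw [hCb]; ring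
  have hmono : Cb * ((N ^ (1 / 2 * pb) * E ^ (1 / (1 + τ))) * E) ≤ Cb * ((N ^ q + E) * E) :=
    mul_le_mul_of_nonneg_left (mul_le_mul_of_nonneg_right hyoung hE) hCb0
  calc 2 * κ * Tb ≤ 2 * κ * (cb₀ * N ^ (1 / 2 : ℝ) * E ^ eE * A ^ eA) :=
        mul_le_mul_of_nonneg_left hTb' (by positivity)
    _ = A ^ eA * (2 * κ * cb₀ * N ^ (1 / 2 : ℝ) * E ^ eE) := by ring
    _ ≤ ε * A + (1 / ε) ^ (eA / (1 - eA)) * (2 * κ * cb₀ * N ^ (1 / 2 : ℝ) * E ^ eE) ^ (1 / (1 - eA)) :=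
        hy
    _ = ε * A + Cb * ((N ^ (1 / 2 * pb) * E ^ (1 / (1 + τ))) * E) := by rw [hZp, hlast]
    _ ≤ ε * A + Cb * ((N ^ q + E) * E) := by linarith only [hmono]
    _ = ε * A + Cb * (N ^ q + E) * E := by ring

/-- The `ω₃ e₃ ∧ u` term `2 T_d`: `2 T_d ≤ εA + ε GP + C E²`. [folklore] -/
private theorem term_d_oc {K K₃ ε : ℝ} (hK : 0 ≤ K) (hK₃ : 0 ≤ K₃) (hε : 0 < ε) :
    ∃ C : ℝ, 0 ≤ C ∧ ∀ (E A G P Td : ℝ), 0 ≤ E → 0 ≤ A → 0 ≤ G → 0 ≤ P →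
      Td ≤ (G ^ ((6 - 3) / (6 - 2) : ℝ) * ((K₃ * P ^ (1 / 2 : ℝ)) ^ (6 : ℝ)) ^ ((3 - 2) / (6 - 2) : ℝ)) ^
            (1 / 3 : ℝ) * (K * E ^ (1 / 2 : ℝ)) * A ^ (1 / 2 : ℝ) →
      2 * Td ≤ ε * A + ε * (G * P) + C * E * E := by
  obtain ⟨cd₀, hcd₀⟩ : ∃ cd₀ : ℝ, cd₀ = 2 * (K₃ ^ (1 / 2 : ℝ) * K) := ⟨_, rfl⟩
  have hcd₀0 : 0 ≤ cd₀ := by rw [hcd₀]; positivity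
  obtain ⟨Cd, hCd⟩ : ∃ Cd : ℝ, Cd = (1 / ε) ^ (3 : ℝ) * cd₀ ^ (4 : ℝ) := ⟨_, rfl⟩
  have hCd0 : 0 ≤ Cd := by rw [hCd]; positivity
  refine ⟨Cd, hCd0, ?_⟩
  intro E A G P Td hE hA hG hP hTd
  obtain ⟨B, hB⟩ : ∃ B : ℝ, B = G * P := ⟨_, rfl⟩
  have hB0 : 0 ≤ B := by rw [hB]; exact mul_nonneg hG hP
  rw [← hB]
  have h34 : ((6 : ℝ) - 3) / (6 - 2) = 3 / 4 := by norm_num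
  have h14 : ((3 : ℝ) - 2) / (6 - 2) = 1 / 4 := by norm_num
  rw [h34, h14] at hTd
  have hKP : 0 ≤ K₃ * P ^ (1 / 2 : ℝ) := mul_nonneg hK₃ (Real.rpow_nonneg hP _)
  have hKP6 : 0 ≤ (K₃ * P ^ (1 / 2 : ℝ)) ^ (6 : ℝ) := Real.rpow_nonneg hKP _
  have hX : (G ^ (3 / 4 : ℝ) * ((K₃ * P ^ (1 / 2 : ℝ)) ^ (6 : ℝ)) ^ (1 / 4 : ℝ)) ^ (1 / 3 : ℝ) =
      K₃ ^ (1 / 2 : ℝ) * (G ^ (1 / 4 : ℝ) * P ^ (1 / 4 : ℝ)) := by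
    rw [Real.mul_rpow (Real.rpow_nonneg hG _) (Real.rpow_nonneg hKP6 _), ← Real.rpow_mul hG,
      ← Real.rpow_mul hKP6, ← Real.rpow_mul hKP, Real.mul_rpow hK₃ (Real.rpow_nonneg hP _),
      ← Real.rpow_mul hP]
    norm_num
    ring
  have hGP : G ^ (1 / 4 : ℝ) * P ^ (1 / 4 : ℝ) = B ^ (1 / 4 : ℝ) := by
    rw [hB, Real.mul_rpow hG hP]
  have hTd' : 2 * Td ≤ A ^ (1 / 2 : ℝ) * B ^ (1 / 4 : ℝ) * (cd₀ * E ^ (1 / 2 : ℝ)) := by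
    calc 2 * Td ≤ 2 * ((G ^ (3 / 4 : ℝ) * ((K₃ * P ^ (1 / 2 : ℝ)) ^ (6 : ℝ)) ^ (1 / 4 : ℝ)) ^ (1 / 3 : ℝ) *
          (K * E ^ (1 / 2 : ℝ)) * A ^ (1 / 2 : ℝ)) := by linarith only [hTd]
      _ = A ^ (1 / 2 : ℝ) * (G ^ (1 / 4 : ℝ) * P ^ (1 / 4 : ℝ)) * (cd₀ * E ^ (1 / 2 : ℝ)) := by
          rw [hX, hcd₀]; ring
      _ = A ^ (1 / 2 : ℝ) * B ^ (1 / 4 : ℝ) * (cd₀ * E ^ (1 / 2 : ℝ)) := by rw [hGP]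
  have hZ0 : 0 ≤ cd₀ * E ^ (1 / 2 : ℝ) := by positivity
  have hy := young3_oc (A := A) (B := B) (Z := cd₀ * E ^ (1 / 2 : ℝ)) (α := 1 / 2) (β := 1 / 4)
    hA hB0 hZ0 (by norm_num) (by norm_num) (by norm_num) hε
  have hZp : (cd₀ * E ^ (1 / 2 : ℝ)) ^ (1 / (1 - 1 / 2 - 1 / 4) : ℝ) = cd₀ ^ (4 : ℝ) * (E * E) := by
    rw [show (1 / (1 - 1 / 2 - 1 / 4) : ℝ) = 4 by norm_num, Real.mul_rpow hcd₀0 (Real.rpow_nonneg hE _),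
      ← Real.rpow_mul hE, show (1 / 2 * 4 : ℝ) = (2 : ℕ) by norm_num, Real.rpow_natCast, sq]
  have hexp3 : ((1 / 2 + 1 / 4) / (1 - 1 / 2 - 1 / 4) : ℝ) = 3 := by norm_num
  rw [hZp, hexp3] at hy
  have hlast : (1 / ε) ^ (3 : ℝ) * (cd₀ ^ (4 : ℝ) * (E * E)) = Cd * E * E := by rw [hCd]; ring
  calc 2 * Td ≤ A ^ (1 / 2 : ℝ) * B ^ (1 / 4 : ℝ) * (cd₀ * E ^ (1 / 2 : ℝ)) := hTd'
    _ ≤ ε * A + ε * B + (1 / ε) ^ (3 : ℝ) * (cd₀ ^ (4 : ℝ) * (E * E)) := hy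
    _ = ε * A + ε * B + Cd * E * E := by rw [hlast]

/-- The right-hand side of the `ω₃`-balance, `2G T_J`: `2G T_J ≤ εA + ε GP + C (N^q + E) G²`.
[folklore] -/
private theorem term_J_oc {r K K₃ κ ε s : ℝ} (hr2 : 2 < r) (hr6 : r ≤ 6) (hK : 0 ≤ K)
    (hK₃ : 0 ≤ K₃) (hε : 0 < ε) (hs : s = 3 * r / (2 * r - 3)) :
    ∃ C : ℝ, 0 ≤ C ∧ ∀ (N E A G P TJ : ℝ), 0 ≤ N → 0 ≤ E → 0 ≤ A → 0 ≤ G → 0 ≤ P →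
      TJ ≤ N * (G ^ ((6 - s) / (6 - 2)) * ((K₃ * P ^ (1 / 2 : ℝ)) ^ (6 : ℝ)) ^ ((s - 2) / (6 - 2))) ^
            (1 / s) *
          ((κ ^ 2 * E) ^ ((6 - 3) / (6 - 2) : ℝ) *
            ((K * (κ ^ 2 * (27 * A)) ^ (1 / 2 : ℝ)) ^ (6 : ℝ)) ^ ((3 - 2) / (6 - 2) : ℝ)) ^ (1 / 3 : ℝ) →
      2 * G * TJ ≤ ε * A + ε * (G * P) + C * (N ^ (4 * r / (3 * r - 6)) + E) * G ^ 2 := by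
  have hr0 : 0 < r := by linarith only [hr2]
  have h2r3 : 0 < 2 * r - 3 := by linarith only [hr2]
  have h3r6 : 0 < 3 * r - 6 := by linarith only [hr2]
  have hr0' : r ≠ 0 := hr0.ne'
  have h2r3' : 2 * r - 3 ≠ 0 := h2r3.ne'
  have h3r6' : 3 * r - 6 ≠ 0 := h3r6.ne'
  obtain ⟨q, hq⟩ : ∃ q : ℝ, q = 4 * r / (3 * r - 6) := ⟨_, rfl⟩
  obtain ⟨κ2, hκ2⟩ : ∃ κ2 : ℝ, κ2 = κ ^ 2 := ⟨_, rfl⟩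
  have hκ20 : 0 ≤ κ2 := by rw [hκ2]; exact sq_nonneg κ
  have hs0 : 0 < s := by rw [hs]; positivity
  have hs0' : s ≠ 0 := hs0.ne'
  have h2s : 2 ≤ s := by rw [hs, le_div_iff₀ h2r3]; linarith only [hr6]
  have hs6' : s < 6 := by rw [hs, div_lt_iff₀ h2r3]; linarith only [hr2]
  obtain ⟨g₁, hg₁⟩ : ∃ g₁ : ℝ, g₁ = (6 - s) / (6 - 2) := ⟨_, rfl⟩
  obtain ⟨p₁, hp₁⟩ : ∃ p₁ : ℝ, p₁ = (s - 2) / (6 - 2) := ⟨_, rfl⟩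
  have hg₁0 : 0 ≤ g₁ := by rw [hg₁]; exact div_nonneg (by linarith only [hs6']) (by norm_num)
  have hp₁0 : 0 ≤ p₁ := by rw [hp₁]; exact div_nonneg (by linarith only [h2s]) (by norm_num)
  obtain ⟨βJ, hβJ⟩ : ∃ βJ : ℝ, βJ = 1 / 2 * (6 * p₁ * (1 / s)) := ⟨_, rfl⟩
  have hβJ' : βJ = 3 * (s - 2) / (4 * s) := by
    rw [hβJ, hp₁]
    field_simp
    ring
  have hβJ0 : 0 ≤ βJ := by rw [hβJ]; positivity
  have hβJ34 : βJ < 3 / 4 := by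
    rw [hβJ', div_lt_div_iff₀ (by positivity) (by norm_num)]
    linarith only [hs0]
  have hβJ1 : 1 / 4 + βJ < 1 := by linarith only [hβJ34]
  obtain ⟨γJ, hγJ⟩ : ∃ γJ : ℝ, γJ = 1 - 1 / 4 - βJ := ⟨_, rfl⟩
  have hγJ' : γJ = 3 / (2 * s) := by
    rw [hγJ, hβJ']
    field_simp
    ring
  have hγJ0 : 0 < γJ := by rw [hγJ']; positivity
  have hγJ0' : γJ ≠ 0 := hγJ0.ne'
  obtain ⟨γ', hγ'⟩ : ∃ γ' : ℝ, γ' = 1 + g₁ * (1 / s) - βJ := ⟨_, rfl⟩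
  have hγ'' : γ' = 3 / s := by
    rw [hγ', hg₁, hβJ']
    field_simp
    ring
  have hγ'0 : 0 ≤ γ' := by rw [hγ'']; positivity
  have hγ'γJ : γ' * (1 / γJ) = 2 := by
    rw [hγ'', hγJ']
    field_simp
  have hγJq : (1 / γJ) * (q * γJ) = q := by field_simp
  have hγJ4 : (1 / 4 * (1 / γJ)) * (4 * γJ) = 1 := by field_simp
  have hγJr : γJ = (2 * r - 3) / (2 * r) := by
    rw [hγJ', hs]
    field_simp
  have hqγ : q * γJ = 2 * (2 * r - 3) / (3 * r - 6) := by
    rw [hγJr, hq, div_mul_div_comm, div_eq_div_iff (by positivity) h3r6']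
    ring
  have hconj_J : (q * γJ).HolderConjugate (4 * γJ) := by
    rw [Real.holderConjugate_iff]
    refine ⟨?_, ?_⟩
    · rw [hqγ, one_lt_div h3r6]; linarith only [hr2]
    · rw [hqγ, hγJr]
      field_simp
      ring
  have hcst0 : 0 ≤ κ2 ^ (1 / 4 : ℝ) * K ^ (1 / 2 : ℝ) * (κ2 * 27) ^ (1 / 4 : ℝ) := by positivity
  obtain ⟨cJ₀, hcJ₀⟩ : ∃ cJ₀ : ℝ, cJ₀ = 2 * (K₃ ^ (6 * p₁ * (1 / s)) *
    (κ2 ^ (1 / 4 : ℝ) * K ^ (1 / 2 : ℝ) * (κ2 * 27) ^ (1 / 4 : ℝ))) := ⟨_, rfl⟩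
  have hcJ₀0 : 0 ≤ cJ₀ := by rw [hcJ₀]; positivity
  obtain ⟨CJ, hCJ⟩ : ∃ CJ : ℝ, CJ = (1 / ε) ^ ((1 / 4 + βJ) / (1 - 1 / 4 - βJ)) * cJ₀ ^ (1 / γJ) :=
    ⟨_, rfl⟩
  have hCJ0 : 0 ≤ CJ := by rw [hCJ]; positivity
  refine ⟨CJ, hCJ0, ?_⟩
  intro N E A G P TJ hN hE hA hG hP hTJ
  obtain ⟨B, hB⟩ : ∃ B : ℝ, B = G * P := ⟨_, rfl⟩
  have hB0 : 0 ≤ B := by rw [hB]; exact mul_nonneg hG hP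
  rw [← hq, ← hB]
  have h34 : ((6 : ℝ) - 3) / (6 - 2) = 3 / 4 := by norm_num
  have h14 : ((3 : ℝ) - 2) / (6 - 2) = 1 / 4 := by norm_num
  rw [h34, h14, ← hg₁, ← hp₁, ← hκ2] at hTJ
  -- nonnegativity of the pieces
  have hKP : 0 ≤ K₃ * P ^ (1 / 2 : ℝ) := mul_nonneg hK₃ (Real.rpow_nonneg hP _)
  have hKP6 : 0 ≤ (K₃ * P ^ (1 / 2 : ℝ)) ^ (6 : ℝ) := Real.rpow_nonneg hKP _
  have hκE : 0 ≤ κ2 * E := mul_nonneg hκ20 hE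
  have hκA : 0 ≤ κ2 * 27 * A := by positivity
  have hY : 0 ≤ K * (κ2 * 27 * A) ^ (1 / 2 : ℝ) := mul_nonneg hK (Real.rpow_nonneg hκA _)
  have hY6 : 0 ≤ (K * (κ2 * 27 * A) ^ (1 / 2 : ℝ)) ^ (6 : ℝ) := Real.rpow_nonneg hY _
  -- the two factors
  have hX1 : (G ^ g₁ * ((K₃ * P ^ (1 / 2 : ℝ)) ^ (6 : ℝ)) ^ p₁) ^ (1 / s) =
      K₃ ^ (6 * p₁ * (1 / s)) * G ^ (g₁ * (1 / s)) * P ^ βJ := by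
    rw [Real.mul_rpow (Real.rpow_nonneg hG _) (Real.rpow_nonneg hKP6 _), ← Real.rpow_mul hG,
      ← Real.rpow_mul hKP6, ← Real.rpow_mul hKP, Real.mul_rpow hK₃ (Real.rpow_nonneg hP _),
      ← Real.rpow_mul hP, hβJ]
    ring
  have hX2 : ((κ2 * E) ^ (3 / 4 : ℝ) * ((K * (κ2 * (27 * A)) ^ (1 / 2 : ℝ)) ^ (6 : ℝ)) ^ (1 / 4 : ℝ)) ^
        (1 / 3 : ℝ) =
      (κ2 ^ (1 / 4 : ℝ) * K ^ (1 / 2 : ℝ) * (κ2 * 27) ^ (1 / 4 : ℝ)) *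
        (E ^ (1 / 4 : ℝ) * A ^ (1 / 4 : ℝ)) := by
    rw [show κ2 * (27 * A) = κ2 * 27 * A by ring,
      Real.mul_rpow (Real.rpow_nonneg hκE _) (Real.rpow_nonneg hY6 _), ← Real.rpow_mul hκE,
      ← Real.rpow_mul hY6, ← Real.rpow_mul hY, Real.mul_rpow hκ20 hE,
      Real.mul_rpow hK (Real.rpow_nonneg hκA _), ← Real.rpow_mul hκA,
      Real.mul_rpow (by positivity : (0:ℝ) ≤ κ2 * 27) hA]
    norm_num
    ring
  have hGsplit : G * G ^ (g₁ * (1 / s)) = G ^ βJ * G ^ γ' := by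
    rw [← Real.rpow_add_of_nonneg hG hβJ0 hγ'0, hγ',
      show βJ + (1 + g₁ * (1 / s) - βJ) = 1 + g₁ * (1 / s) by ring,
      Real.rpow_add_of_nonneg hG zero_le_one (by positivity), Real.rpow_one]
  have hGP : G ^ βJ * P ^ βJ = B ^ βJ := by rw [hB, Real.mul_rpow hG hP]
  have hfac : 0 ≤ (G ^ g₁ * ((K₃ * P ^ (1 / 2 : ℝ)) ^ (6 : ℝ)) ^ p₁) ^ (1 / s) *
      ((κ2 * E) ^ (3 / 4 : ℝ) * ((K * (κ2 * (27 * A)) ^ (1 / 2 : ℝ)) ^ (6 : ℝ)) ^ (1 / 4 : ℝ)) ^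
        (1 / 3 : ℝ) := by
    rw [hX1, hX2]
    positivity
  have hTJ' : 2 * G * TJ ≤ A ^ (1 / 4 : ℝ) * B ^ βJ * (cJ₀ * N * E ^ (1 / 4 : ℝ) * G ^ γ') := by
    calc 2 * G * TJ ≤ 2 * G * (N * (G ^ g₁ * ((K₃ * P ^ (1 / 2 : ℝ)) ^ (6 : ℝ)) ^ p₁) ^ (1 / s) *
          ((κ2 * E) ^ (3 / 4 : ℝ) * ((K * (κ2 * (27 * A)) ^ (1 / 2 : ℝ)) ^ (6 : ℝ)) ^ (1 / 4 : ℝ)) ^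
            (1 / 3 : ℝ)) := mul_le_mul_of_nonneg_left hTJ (by positivity)
      _ = 2 * N * (G * G ^ (g₁ * (1 / s))) * P ^ βJ * K₃ ^ (6 * p₁ * (1 / s)) *
          ((κ2 ^ (1 / 4 : ℝ) * K ^ (1 / 2 : ℝ) * (κ2 * 27) ^ (1 / 4 : ℝ)) *
            (E ^ (1 / 4 : ℝ) * A ^ (1 / 4 : ℝ))) := by
          rw [hX1, hX2]; ring
      _ = A ^ (1 / 4 : ℝ) * (G ^ βJ * P ^ βJ) * (cJ₀ * N * E ^ (1 / 4 : ℝ) * G ^ γ') := by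
          rw [hGsplit, hcJ₀]; ring
      _ = A ^ (1 / 4 : ℝ) * B ^ βJ * (cJ₀ * N * E ^ (1 / 4 : ℝ) * G ^ γ') := by rw [hGP]
  have hZ0 : 0 ≤ cJ₀ * N * E ^ (1 / 4 : ℝ) * G ^ γ' := by positivity
  have hy := young3_oc (A := A) (B := B) (Z := cJ₀ * N * E ^ (1 / 4 : ℝ) * G ^ γ') (α := 1 / 4)
    (β := βJ) hA hB0 hZ0 (by norm_num) hβJ0 hβJ1 hε
  have hZp : (cJ₀ * N * E ^ (1 / 4 : ℝ) * G ^ γ') ^ (1 / (1 - 1 / 4 - βJ)) =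
      cJ₀ ^ (1 / γJ) * (N ^ (1 / γJ) * E ^ (1 / 4 * (1 / γJ))) * G ^ 2 := by
    have h1 : 0 ≤ cJ₀ * N := mul_nonneg hcJ₀0 hN
    have h2 : 0 ≤ cJ₀ * N * E ^ (1 / 4 : ℝ) := mul_nonneg h1 (Real.rpow_nonneg hE _)
    rw [← hγJ, Real.mul_rpow h2 (Real.rpow_nonneg hG _), Real.mul_rpow h1 (Real.rpow_nonneg hE _),
      Real.mul_rpow hcJ₀0 hN, ← Real.rpow_mul hE, ← Real.rpow_mul hG, hγ'γJ, Real.rpow_two]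
    ring
  have hyoung : N ^ (1 / γJ) * E ^ (1 / 4 * (1 / γJ)) ≤ N ^ q + E := by
    have h := mul_le_rpow_add_rpow_oc (Real.rpow_nonneg hN (1 / γJ))
      (Real.rpow_nonneg hE (1 / 4 * (1 / γJ))) hconj_J
    rwa [← Real.rpow_mul hN, ← Real.rpow_mul hE, hγJq, hγJ4, Real.rpow_one] at h
  rw [hZp] at hy
  have hlast : (1 / ε) ^ ((1 / 4 + βJ) / (1 - 1 / 4 - βJ)) *
        (cJ₀ ^ (1 / γJ) * (N ^ (1 / γJ) * E ^ (1 / 4 * (1 / γJ))) * G ^ 2) =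
      CJ * ((N ^ (1 / γJ) * E ^ (1 / 4 * (1 / γJ))) * G ^ 2) := by rw [hCJ]; ring
  have hmono : CJ * ((N ^ (1 / γJ) * E ^ (1 / 4 * (1 / γJ))) * G ^ 2) ≤ CJ * ((N ^ q + E) * G ^ 2) :=
    mul_le_mul_of_nonneg_left (mul_le_mul_of_nonneg_right hyoung (sq_nonneg G)) hCJ0
  calc 2 * G * TJ ≤ A ^ (1 / 4 : ℝ) * B ^ βJ * (cJ₀ * N * E ^ (1 / 4 : ℝ) * G ^ γ') := hTJ'
    _ ≤ ε * A + ε * B + (1 / ε) ^ ((1 / 4 + βJ) / (1 - 1 / 4 - βJ)) *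
        (cJ₀ ^ (1 / γJ) * (N ^ (1 / γJ) * E ^ (1 / 4 * (1 / γJ))) * G ^ 2) := hy
    _ = ε * A + ε * B + CJ * ((N ^ (1 / γJ) * E ^ (1 / 4 * (1 / γJ))) * G ^ 2) := by rw [hlast]
    _ ≤ ε * A + ε * B + CJ * ((N ^ q + E) * G ^ 2) := by linarith only [hmono]
    _ = ε * A + ε * B + CJ * (N ^ q + E) * G ^ 2 := by ring

end Terms

/-! ### The bookkeeping -/

section Bookkeeping

/-- **The differential inequality of Prop. 11.5, real-variable form** (Lemarié-Rieusset 2016,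
proof of Prop. 11.5, (11.28)–(11.30): with `A = ‖Δu‖₂²`, `E = ‖∇u‖₂² = Σⱼaⱼ`, `Σⱼ Rⱼ = A`
(Hessian–Laplacian identity), `G = ‖ω₃‖₂²`, `P = ‖∇ω₃‖₂²`, `N = ‖∇u₃‖_r`, the production terms
`T_c = ∫|∇u₃||∇u|²`, `T_b = ∫|∇u₃||u||∇²u|`, `T_d = ∫|Δu||u||ω₃|`, `T_J = ∫|ω₃||ω||∇u₃|` bounded as
in `OneComponentSliceBounds` and the tree's weighted key estimate, and the balances
`R_I ≤ -νA + (5/2+8κ)T_c + 2κT_b + 2T_d` (`OneComponentEnstrophyProduction`),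
`R_G ≤ -νP + T_J` (`OneComponentVorticityBalance`), every product is split by Young's inequality
into a quarter of the dissipation and a term `C (1 + N^q + E)(1 + E + G²)`, `q = 4r/(3r-6)`
(`2/q + 3/r = 3/2`), for `2 < r ≤ 6`). The constant depends on `ν`, `r` and the four constants
`K₁, K₃, K_A, κ` only.
[cite: LemarieRieusset2016, §11.5 Prop. 11.5 proof, (11.28)–(11.30) (PDF pp. 355–356)] -/
theorem oneComponent_slice_algebra {ν r : ℝ} (hν : 0 < ν) (hr2 : 2 < r) (hr6 : r ≤ 6)
    {K K₃ KA κ : ℝ} (hK : 0 ≤ K) (hK₃ : 0 ≤ K₃) (hKA : 0 ≤ KA) (hκ : 0 ≤ κ)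
    {σ s : ℝ} (hσ : σ = 4 * r / (r - 2)) (hs : s = 3 * r / (2 * r - 3)) :
    ∃ C : ℝ, 0 ≤ C ∧ ∀ (N N₀ E A G P Tc Tb Td TJ RI RG : ℝ) (a R : Fin 3 → ℝ),
      0 ≤ N → 0 ≤ N₀ → 0 ≤ E → 0 ≤ A → 0 ≤ G → 0 ≤ P → (∀ j, 0 ≤ a j) → (∀ j, 0 ≤ R j) →
      ∑ j, a j = E → ∑ j, R j = A →
      RI ≤ -ν * A + (5 / 2 + 8 * κ) * Tc + 2 * κ * Tb + 2 * Td →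
      RG ≤ -ν * P + TJ →
      Tc ≤ ∑ j, N * a j ^ (1 - 3 / (2 * r)) * (K ^ 2 * R j) ^ (3 / (2 * r)) →
      N₀ ≤ E ^ (1 / 4 : ℝ) * N ^ (1 / 2 : ℝ) →
      Tb ≤ N₀ * ((KA * (E * A) ^ (1 / 4 : ℝ)) ^ ((σ - 6) / σ) * (K * E ^ (1 / 2 : ℝ)) ^ (6 / σ)) *
          (27 * A) ^ (1 / 2 : ℝ) →
      Td ≤ (G ^ ((6 - 3) / (6 - 2) : ℝ) * ((K₃ * P ^ (1 / 2 : ℝ)) ^ (6 : ℝ)) ^ ((3 - 2) / (6 - 2) : ℝ)) ^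
            (1 / 3 : ℝ) * (K * E ^ (1 / 2 : ℝ)) * A ^ (1 / 2 : ℝ) →
      TJ ≤ N * (G ^ ((6 - s) / (6 - 2)) * ((K₃ * P ^ (1 / 2 : ℝ)) ^ (6 : ℝ)) ^ ((s - 2) / (6 - 2))) ^
            (1 / s) *
          ((κ ^ 2 * E) ^ ((6 - 3) / (6 - 2) : ℝ) *
            ((K * (κ ^ 2 * (27 * A)) ^ (1 / 2 : ℝ)) ^ (6 : ℝ)) ^ ((3 - 2) / (6 - 2) : ℝ)) ^ (1 / 3 : ℝ) →
      RI + 2 * G * RG ≤ C * (1 + N ^ (4 * r / (3 * r - 6)) + E) * (1 + E + G ^ 2) := by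
  have hε : 0 < ν / 4 := by positivity
  have hc₁ : 0 < 5 / 2 + 8 * κ := by positivity
  obtain ⟨Cc, hCc0, hc⟩ := term_c_oc (K := K) (ε := ν / 4) (c₁ := 5 / 2 + 8 * κ) hr2 hε hc₁
  obtain ⟨Cb, hCb0, hb⟩ := term_b_oc (ε := ν / 4) hr2 hr6 hK hKA hκ hε hσ
  obtain ⟨Cd, hCd0, hd⟩ := term_d_oc (ε := ν / 4) hK hK₃ hε
  obtain ⟨CJ, hCJ0, hJ⟩ := term_J_oc (κ := κ) (ε := ν / 4) hr2 hr6 hK hK₃ hε hs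
  refine ⟨Cc + Cb + Cd + CJ, by positivity, ?_⟩
  intro N N₀ E A G P Tc Tb Td TJ RI RG a R hN hN₀ hE hA hG hP ha hR haE hRA hRI hRG hTc hN₀le
    hTb hTd hTJ
  have hA0 : 0 ≤ A := hA
  have h1 := hc N E A Tc a R hN hE ha hR haE hRA hTc
  have h2 := hb N N₀ E A Tb hN hN₀ hE hA hN₀le hTb
  have h3 := hd E A G P Td hE hA hG hP hTd
  have h4 := hJ N E A G P TJ hN hE hA hG hP hTJ
  obtain ⟨W, hW⟩ : ∃ W : ℝ, W = 1 + N ^ (4 * r / (3 * r - 6)) + E := ⟨_, rfl⟩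
  obtain ⟨Kf, hKf⟩ : ∃ Kf : ℝ, Kf = 1 + E + G ^ 2 := ⟨_, rfl⟩
  rw [← hW, ← hKf]
  have hNq0 : 0 ≤ N ^ (4 * r / (3 * r - 6)) := Real.rpow_nonneg hN _
  have hG2 : 0 ≤ G ^ 2 := sq_nonneg G
  have hGP0 : 0 ≤ G * P := mul_nonneg hG hP
  -- `2 G R_G ≤ -2ν GP + 2 G T_J`
  have hRG' : 2 * G * RG ≤ -(2 * ν) * (G * P) + 2 * G * TJ := by
    have h := mul_le_mul_of_nonneg_left hRG (by positivity : (0:ℝ) ≤ 2 * G)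
    have : 2 * G * (-ν * P + TJ) = -(2 * ν) * (G * P) + 2 * G * TJ := by ring
    linarith only [h, this]
  have hsum : RI + 2 * G * RG ≤
      Cc * (1 + N ^ (4 * r / (3 * r - 6))) * E + Cb * (N ^ (4 * r / (3 * r - 6)) + E) * E +
        Cd * E * E + CJ * (N ^ (4 * r / (3 * r - 6)) + E) * G ^ 2 := by
    nlinarith only [hRI, hRG', h1, h2, h3, h4, hGP0, hν, hA0]
  have hW0 : 0 ≤ W := by rw [hW]; positivity
  have hE_Kf : E ≤ Kf := by rw [hKf]; linarith only [hG2]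
  have hG_Kf : G ^ 2 ≤ Kf := by rw [hKf]; linarith only [hE]
  have k1 : Cc * (1 + N ^ (4 * r / (3 * r - 6))) * E ≤ Cc * W * Kf := by
    have h : (1 + N ^ (4 * r / (3 * r - 6))) * E ≤ W * Kf :=
      mul_le_mul (by rw [hW]; linarith only [hE]) hE_Kf hE hW0
    have := mul_le_mul_of_nonneg_left h hCc0
    linarith only [this]
  have k2 : Cb * (N ^ (4 * r / (3 * r - 6)) + E) * E ≤ Cb * W * Kf := by
    have h : (N ^ (4 * r / (3 * r - 6)) + E) * E ≤ W * Kf :=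
      mul_le_mul (by rw [hW]; linarith only [hE]) hE_Kf hE hW0
    have := mul_le_mul_of_nonneg_left h hCb0
    linarith only [this]
  have k3 : Cd * E * E ≤ Cd * W * Kf := by
    have h : E * E ≤ W * Kf := mul_le_mul (by rw [hW]; linarith only [hE, hNq0]) hE_Kf hE hW0
    have := mul_le_mul_of_nonneg_left h hCd0
    linarith only [this]
  have k4 : CJ * (N ^ (4 * r / (3 * r - 6)) + E) * G ^ 2 ≤ CJ * W * Kf := by
    have h : (N ^ (4 * r / (3 * r - 6)) + E) * G ^ 2 ≤ W * Kf :=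
      mul_le_mul (by rw [hW]; linarith only [hE]) hG_Kf hG2 hW0
    have := mul_le_mul_of_nonneg_left h hCJ0
    linarith only [this]
  calc RI + 2 * G * RG ≤
      Cc * (1 + N ^ (4 * r / (3 * r - 6))) * E + Cb * (N ^ (4 * r / (3 * r - 6)) + E) * E +
        Cd * E * E + CJ * (N ^ (4 * r / (3 * r - 6)) + E) * G ^ 2 := hsum
    _ ≤ Cc * W * Kf + Cb * W * Kf + Cd * W * Kf + CJ * W * Kf := by linarith only [k1, k2, k3, k4]
    _ = (Cc + Cb + Cd + CJ) * W * Kf := by ring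

end Bookkeeping

end Literature.Analysis.FluidPDE
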